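import Literature.MathematicalPhysics.QuantumFieldTheory.Balaban1983to89.B4ContourShift
import Literature.MathematicalPhysics.QuantumFieldTheory.Balaban1983to89.B4Green244
import Literature.MathematicalPhysics.QuantumFieldTheory.Balaban1983to89.B5Strip145Analytic

/-!
# `Balaban1983to89.Beta.FibreInverseDecay` — a matrix-valued lattice multiplier that is NONSINGULAR ON THE REAL BRILLOUIN ZONE
# has an inverse whose entries are strip regular on a POSITIVE strip, hence an EXPONENTIALLY DECAYING inverse kernel, which is
# the two-sided fundamental solution of the finite-difference operator (generic Floquet–Paley–Wiener engine; [folklore])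

CITATION HEADER (lean-in-tree rule 2026-08-18).  This module is a GENERIC SUPPLEMENT to `…Balaban1983to89.B4ContourShift`
(unit `b2b-balaban-pv17`: the interface `StripRegular G κ M` and the kernel theorem `latticeKernel_decay :
StripRegular G κ M → |K(x)| ≤ M e^{−κ|x|_∞}`, with `stripRegular_inv` for a SCALAR symbol BOUNDED BELOW on a given strip) and
to `…B4Green244` §5 (unit `b2b-balaban-b04`/`pv17`: the lattice-kernel calculus `latticeKernel_phase_mul`,
`latticeKernel_sum_mul`, `latticeKernel_congr`, `latticeKernel_one`).  It reproduces NO statement of Bałaban's papers and uses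
NO published theorem as a hypothesis; every declaration is [folklore].  What it adds is the QUALITATIVE step those modules leave
to their instantiations — there the lower bound `|F| ≥ c` on a strip is supplied by the k-uniform estimates of B4/B5
(`B4StripCauchy.uniformStrip_holds`, `B5Strip145Leaves.uniformStrip145_holds`); here it comes from COMPACTNESS alone:

 * §1 `isCompact_Strip` (the strip `B4Strip.Strip d κ` is a product of closed rectangles) and **`exists_strip_lower_of_ne_zero`**:
   a multiplier `F` continuous on `Strip d κ₀`, `κ₀ > 0`, and nonvanishing at the REAL momenta of the zone is bounded below,
   `|F| ≥ c > 0`, on some `Strip d κ`, `0 < κ ≤ κ₀` (extreme value theorem on the real zone + Heine–Cantor uniform continuity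
   on the compact strip + `dist(p, Re p) ≤ κ`) — the qualitative twin of `B4Strip.strip_lower_bound`.
 * §2 `StripHolo G κ` = the three analytic hypotheses of `StripRegular` WITHOUT the bound (continuity on the closed strip, slice
   holomorphy on the open rectangles through real base points, matching vertical sides); on the compact strip a bound always
   exists (`StripHolo.exists_stripRegular`); closure under `+`, `·`, finite sums/products, restriction, and inverse of a
   zero-free symbol; `StripHolo.stripRegular_inv` repackages `B4ContourShift.stripRegular_inv`.
 * §3 MATRIX multipliers `A : ℂ^{d+1} → Mat_n(ℂ)`: `stripHolo_det` (Leibniz formula `Matrix.det_apply'`), `stripHolo_adjugate`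
   (`Matrix.adjugate_apply`: a determinant with one row replaced by a basis vector), `inv_apply_eq`
   (`A⁻¹ = det⁻¹ • adj`, `Matrix.inv_def`), `det_ne_zero_of_mulVec_injective` (the UNIQUENESS form of nonsingularity), and
   THE ENGINE **`exists_stripRegular_inv`**: entries strip holomorphic on `Strip κ₀` + `det A(p) ≠ 0` for real `p` in the zone
   ⟹ `∃ 0 < κ ≤ κ₀, M ≥ 0, ∀ i j, StripRegular (p ↦ (A p)⁻¹ᵢⱼ) κ M`; whence **`inv_latticeKernel_decay`** /
   `inv_latticeKernel_decay_of_injective`: `‖K_{ij}(x)‖ ≤ M e^{−κ|x|_∞}` for the lattice kernels of all entries of `A⁻¹`, and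
   the `ℓ¹` form `inv_latticeKernel_decay_l1` (`≤ M e^{−δ Σ_μ|x_μ|}`, the shape of the cell's `B12Sec2to5.Decay510`).
 * §4 TRIGONOMETRIC-POLYNOMIAL matrix multipliers `trigPolySymbol S L p = Σ_{a ∈ S} e^{ip·a} L_a` (`S ⊂ ℤ^{d+1}` finite,
   `L_a ∈ Mat_n(ℂ)`) — the Floquet–Bloch fibre matrices of a finite-range operator `(𝕃u)(x) = Σ_{a∈S} L_a u(x+a)` commuting
   with the translations of `ℤ^{d+1}` (for an operator periodic under a SUBLATTICE: coarse cell coordinates, intra-cell and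
   component labels = the matrix indices): the character `cphase a` is entire and `2π`-periodic (`stripHolo_cphase`, via
   `B4ContourShift.sides_of_periodic`), so the entries are strip holomorphic on EVERY strip (`stripHolo_trigPolySymbol`) and
   the engine gives **`trigPolySymbol_inv_decay`** / `…_of_injective` / `trigPolySymbol_exists_stripRegular_inv`:
   «nonsingular (equivalently: injective on vectors) at every real momentum ⟹ exponentially decaying inverse kernel».
 * §5 the inverse kernel `invKernel S L x = ((2π)^{-(d+1)} ∫ (A(p)⁻¹)_{ij} e^{ip·x} dp)_{ij}` (`invKernel_decay`,
   `invKernel_decay_l1`) IS THE TWO-SIDED FUNDAMENTAL SOLUTION: **`fundamental_left`** `Σ_{a∈S} L_a K(x+a) = δ_{x,0}·1` and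
   **`fundamental_right`** `Σ_{a∈S} K(x+a) L_a = δ_{x,0}·1` (shift rule + superposition, the integrability of every
   `e^{ip·a}(A⁻¹)_{kj}` coming from its strip regularity, + `A A⁻¹ = 1` on the zone + `latticeKernel_one`).

PRINTED FORM OF THE PRINCIPLE (secondary literature, located by this lineage in `HOME/BETA/TRANSFER.md` §23/§26; quoted for
orientation, NOT used): P. Kuchment, *An overview of periodic elliptic operators*, Bull. AMS **53** (2016) 343–414
[Kuchment2016] (held `paper:arxiv-1510.00971`), §4.2 "Plancherel and Paley–Wiener type theorems" (arXiv numbering), third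
bullet, VERBATIM: "𝒰f(·,k) is analytic in a complex neighborhood of 𝕋* as a function with values in L²(W), iff the norms
‖f‖_{L²(W+γ)} decay exponentially fast when |γ| ↦ ∞."; the scalar lattice instance is K. Gawędzki, A. Kupiainen, CMP **77**
(1980) Prop. A.2 p. 60 (quoted in `B4ContourShift`'s header).  In Bałaban's series the CONCLUSION of this engine for the
gauge-fixed propagators is STATED for the infinite lattice in a parenthesis: T. Bałaban, *Propagators and renormalization
transformations for lattice gauge theories. II*, Commun. Math. Phys. **96** (1984) 223–250 [Balaban1984PropagatorsII] (cell
paper B6), Proposition 2.5 p. 246 [PDF 24], VERBATIM (text layer of the held scan `paper:balaban1984-cmp96-propagators-rt-ii`):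
"The operator G_□ defined by (2.90) on the torus T_□ (or on the whole lattice ξZ^d) has the representation (2.129) and
satisfies all the inequalities (1.110)–(1.114) of the Proposition 1.2 with a positive constant δ₂ instead of δ₀. This constant
depends on d and L only." (cell records C-B6-5, G-B6-06/07; BETA-SPEC v1.9x §7.24 (R13-2)(α): «vector: asserted») — this file
neither uses nor certifies that sentence; it supplies the generic analytic half of the KERNEL ROUTE P1-K by which the β sub-cell
proposes to PROVE the U = 1 infinite-lattice objects directly (BETA-SPEC v1.9x §7.24 (d)(iii); an2-g5 NOTE 2026-08-19T02:48:00Z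
(2)(ii), CLAIMS.log l. 9787).

CONSUMER AND DIVISION OF LABOUR (β sub-cell, route P1-K for the (O1′) `InfiniteVolumeSpec` instance): an2's (D3)
`Beta/BlochFibreUniqueness.blochFibre_uniqueness` gives, for every unitary character, triviality of the Bloch-periodic
homogeneous KKT system, i.e. INJECTIVITY of the fibre matrix at every real quasi-momentum once the block-periodic operator is
written in cell coordinates as some `trigPolySymbol S L` (an2's (D4) bookkeeping, NOT done here); this file then delivers the
strip, the decay (sup-norm and `ℓ¹` forms) and the fundamental-solution identities; the `InfiniteVolumeSpec` fields, the
`AbsMoment₂`/`Decay510` packaging (`DecimatedMomentSummable.absMoment₂_of_decay510`) and the torus periodisation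
(`B4TorusKernel.torusKernel_descend_eq` on the `StripRegular` output of `trigPolySymbol_exists_stripRegular_inv`) stay with
their owners.  UNIFORMITY: none is claimed — `κ, M` depend on the multiplier (hence on the block size); this is exactly the
QUALITATIVE use P1-K makes of the instance (BETA-SPEC §7.24 (d)(iii) «size M, no N-uniform estimate anywhere»).
DIMENSION CONVENTION as `B4ContourShift`: lattice `ℤ^{d+1}` (`Fin (d+1)`); instantiate `d + 1 = 4`.
Inputs: Mathlib + the two sibling modules named above (+ `B5Strip145Analytic.strip_mono`); no `sorry`, no axiom beyond the standard three, no `opaque`, no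
`def … : Prop` hypothesis.  VALUE: generic kernel engine for a located step of the (O1′)-instance route; NOT a result of the
papers, NOT summit progress.  HONEST FRAMING (cell): discharging `BetaPertH` would make Bałaban's UV stability unconditional —
NOT the continuum limit, NOT the Clay problem; this file discharges nothing of it.  Unit `b2b-balaban-beta-lit2` (β sub-cell
LIT2 = literature/transfer seat, gen 10); staged byte-identically in the cell package
`run/shared/lean/pub/pub-balaban/lean/BalabanYm4/Literature/MathematicalPhysics/QuantumFieldTheory/Balaban1983to89/Beta/FibreInverseDecay.lean`;
records `HOME/BETA/TRANSFER.md` §26, `HOME/BETA/LIT2.md` v3.6, GAPS C-lit2g10-1.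
-/

namespace Literature.MathematicalPhysics.QuantumFieldTheory.Balaban1983to89.Beta.FibreInverseDecay

open Complex Set
open Literature.MathematicalPhysics.QuantumFieldTheory.Balaban1983to89.B4Strip (ofRealVec Strip reVec)
open Literature.MathematicalPhysics.QuantumFieldTheory.Balaban1983to89.B4ContourShift
open Literature.MathematicalPhysics.QuantumFieldTheory.Balaban1983to89.B5Strip145Analytic (strip_mono)
open scoped Real

noncomputable section

variable {d : ℕ}

/-! ### §1. The strip is compact; a multiplier nonvanishing on the real zone is bounded below on a smaller strip -/

/-- the strip is the product of `d` copies of the closed rectangle `[-π, π] × [-κ, κ]`. [folklore] -/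
theorem Strip_eq_pi (d : ℕ) (κ : ℝ) :
    Strip d κ = Set.univ.pi (fun _ : Fin d => Icc (-π) π ×ℂ Icc (-κ) κ) := by
  ext p
  simp [Strip, Complex.mem_reProdIm, abs_le]

/-- the strip `Strip d κ` is compact. [folklore] -/
theorem isCompact_Strip (d : ℕ) (κ : ℝ) : IsCompact (Strip d κ) := by
  rw [Strip_eq_pi]
  exact isCompact_univ_pi fun _ => isCompact_Icc.reProdIm isCompact_Icc

/-- the real part of a strip point lies in the Brillouin zone. [folklore] -/
theorem reVec_mem_BZ {κ : ℝ} {p : Fin d → ℂ} (hp : p ∈ Strip d κ) : reVec p ∈ BZ d :=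
  ⟨fun μ => (abs_le.mp (hp μ).1).1, fun μ => (abs_le.mp (hp μ).1).2⟩

/-- the Brillouin zone is compact. [folklore] -/
theorem isCompact_BZ (d : ℕ) : IsCompact (BZ d) := isCompact_Icc

/-- the Brillouin zone is nonempty (it contains `0`). [folklore] -/
theorem BZ_nonempty (d : ℕ) : (BZ d).Nonempty :=
  ⟨fun _ => 0, fun _ => by simp [Real.pi_pos.le], fun _ => by simp [Real.pi_pos.le]⟩

/-- a complex number differs from its real part by its imaginary part: `‖z - Re z‖ = |Im z|`. [folklore] -/
theorem norm_sub_re (z : ℂ) : ‖z - (z.re : ℂ)‖ = |z.im| := by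
  have h : z - (z.re : ℂ) = (z.im : ℂ) * I := by
    apply Complex.ext <;> simp
  rw [h, norm_mul, Complex.norm_I, mul_one, Complex.norm_real, Real.norm_eq_abs]

/-- a strip point is within `κ` (sup distance) of its real part. [folklore] -/
theorem dist_ofRealVec_reVec_le {κ : ℝ} (hκ : 0 ≤ κ) {p : Fin d → ℂ} (hp : p ∈ Strip d κ) :
    dist p (ofRealVec (reVec p)) ≤ κ := by
  refine (dist_pi_le_iff hκ).mpr fun μ => ?_
  rw [Complex.dist_eq]
  show ‖p μ - ((p μ).re : ℂ)‖ ≤ κ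
  rw [norm_sub_re]
  exact (hp μ).2

/-- THE QUALITATIVE STRIP LEMMA (compactness; the qualitative twin of `B4Strip.strip_lower_bound`).  A multiplier `F` that is
continuous on the strip of half-width `κ₀ > 0` and does not vanish at the REAL momenta of the Brillouin zone is bounded below in
modulus, `|F| ≥ c > 0`, on some strip of positive half-width `κ ≤ κ₀`.  Proof: `|F| ≥ 2c` on the compact real zone (extreme
value theorem), `F` is uniformly continuous on the compact strip (Heine–Cantor), and a point of `Strip κ` is within `κ` of its real
part. [folklore] -/
theorem exists_strip_lower_of_ne_zero {F : (Fin d → ℂ) → ℂ} {κ₀ : ℝ} (hκ₀ : 0 < κ₀)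
    (hc : ContinuousOn F (Strip d κ₀)) (hne : ∀ s ∈ BZ d, F (ofRealVec s) ≠ 0) :
    ∃ κ c : ℝ, 0 < κ ∧ κ ≤ κ₀ ∧ 0 < c ∧ ∀ p ∈ Strip d κ, c ≤ ‖F p‖ := by
  -- the real zone: minimum of `‖F‖`
  have hmaps : MapsTo (ofRealVec : (Fin d → ℝ) → Fin d → ℂ) (BZ d) (Strip d κ₀) :=
    fun s hs => ofRealVec_mem_Strip hκ₀.le hs
  have hg : ContinuousOn (fun s : Fin d → ℝ => ‖F (ofRealVec s)‖) (BZ d) :=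
    (hc.comp continuous_ofRealVec.continuousOn hmaps).norm
  obtain ⟨s₀, hs₀, hmin⟩ := (isCompact_BZ d).exists_isMinOn (BZ_nonempty d) hg
  set m : ℝ := ‖F (ofRealVec s₀)‖ with hm
  have hmpos : 0 < m := norm_pos_iff.mpr (hne s₀ hs₀)
  -- uniform continuity on the big strip
  have huc : UniformContinuousOn F (Strip d κ₀) := (isCompact_Strip d κ₀).uniformContinuousOn_of_continuous hc
  obtain ⟨δ, hδ, hδF⟩ := Metric.uniformContinuousOn_iff.mp huc (m / 2) (by positivity)
  refine ⟨min κ₀ (δ / 2), m / 2, lt_min hκ₀ (by positivity), min_le_left _ _, by positivity, ?_⟩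
  intro p hp
  have hκ : 0 ≤ min κ₀ (δ / 2) := (lt_min hκ₀ (by positivity : (0:ℝ) < δ / 2)).le
  have hp₀ : p ∈ Strip d κ₀ := strip_mono (min_le_left _ _) hp
  have hq_BZ : reVec p ∈ BZ d := reVec_mem_BZ hp
  have hq₀ : ofRealVec (reVec p) ∈ Strip d κ₀ := ofRealVec_mem_Strip hκ₀.le hq_BZ
  have hdist : dist p (ofRealVec (reVec p)) < δ :=
    lt_of_le_of_lt ((dist_ofRealVec_reVec_le hκ hp).trans (min_le_right _ _)) (by linarith)
  have h1 : dist (F p) (F (ofRealVec (reVec p))) < m / 2 := hδF p hp₀ _ hq₀ hdist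
  have h2 : m ≤ ‖F (ofRealVec (reVec p))‖ := hmin hq_BZ
  rw [dist_eq_norm] at h1
  have h3 : ‖F (ofRealVec (reVec p))‖ ≤ ‖F p‖ + ‖F p - F (ofRealVec (reVec p))‖ := by
    calc ‖F (ofRealVec (reVec p))‖ = ‖F p - (F p - F (ofRealVec (reVec p)))‖ := by ring_nf
      _ ≤ ‖F p‖ + ‖F p - F (ofRealVec (reVec p))‖ := norm_sub_le _ _
  linarith

/-! ### §2. Strip-holomorphic multipliers (the hypotheses of `B4ContourShift.StripRegular` without the bound) -/

/-- A multiplier `G` is STRIP HOLOMORPHIC of half-width `κ` if it is continuous on `Strip (d+1) κ`, each coordinate slice through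
a real point of the zone is holomorphic on the open rectangle `(-π,π) × (-κ,κ)`, and the slices match on the vertical sides
`Re p_i = ±π` — i.e. `B4ContourShift.StripRegular G κ M` without the bound `M`. [folklore] -/
structure StripHolo (G : (Fin (d + 1) → ℂ) → ℂ) (κ : ℝ) : Prop where
  cont : ContinuousOn G (Strip (d + 1) κ)
  diff : ∀ (i : Fin (d + 1)) (q : Fin d → ℝ), q ∈ BZ d →
    DifferentiableOn ℂ (fun z => G (i.insertNth z (ofRealVec q))) (openRect κ)
  sides : ∀ (i : Fin (d + 1)) (q : Fin d → ℝ), q ∈ BZ d → ∀ y : ℝ, |y| ≤ κ →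
    G (i.insertNth (-π + y * I) (ofRealVec q)) = G (i.insertNth (π + y * I) (ofRealVec q))

/-- a strip-regular multiplier is strip holomorphic. [folklore] -/
theorem stripHolo_of_stripRegular {G : (Fin (d + 1) → ℂ) → ℂ} {κ M : ℝ} (h : StripRegular G κ M) :
    StripHolo G κ :=
  ⟨h.cont, h.diff, h.sides⟩

/-- a strip-holomorphic multiplier is BOUNDED on the (compact) strip, hence strip regular with some bound `M ≥ 0`. [folklore] -/
theorem StripHolo.exists_stripRegular {G : (Fin (d + 1) → ℂ) → ℂ} {κ : ℝ} (h : StripHolo G κ) :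
    ∃ M : ℝ, 0 ≤ M ∧ StripRegular G κ M := by
  obtain ⟨C, hC⟩ := (isCompact_Strip (d + 1) κ).exists_bound_of_continuousOn h.cont
  exact ⟨max C 0, le_max_right _ _, ⟨h.cont, h.diff, h.sides, fun p hp => (hC p hp).trans (le_max_left _ _)⟩⟩

/-- restriction to a narrower strip. [folklore] -/
theorem StripHolo.of_le {G : (Fin (d + 1) → ℂ) → ℂ} {κ κ' : ℝ} (h : StripHolo G κ) (hκ' : κ' ≤ κ) :
    StripHolo G κ' := by
  have hR : openRect κ' ⊆ openRect κ := fun z hz => ⟨hz.1, ⟨by linarith [hz.2.1], by linarith [hz.2.2]⟩⟩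
  exact ⟨h.cont.mono (strip_mono hκ'), fun i q hq => (h.diff i q hq).mono hR,
    fun i q hq y hy => h.sides i q hq y (hy.trans hκ')⟩

/-- constants are strip holomorphic. [folklore] -/
theorem stripHolo_const (a : ℂ) (κ : ℝ) : StripHolo (fun _ : Fin (d + 1) → ℂ => a) κ :=
  ⟨continuousOn_const, fun _ _ _ => differentiableOn_const a, fun _ _ _ _ _ => rfl⟩

/-- sums. [folklore] -/
theorem StripHolo.add {G₁ G₂ : (Fin (d + 1) → ℂ) → ℂ} {κ : ℝ} (h₁ : StripHolo G₁ κ) (h₂ : StripHolo G₂ κ) :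
    StripHolo (fun p => G₁ p + G₂ p) κ := by
  refine ⟨h₁.cont.add h₂.cont, fun i q hq => (h₁.diff i q hq).add (h₂.diff i q hq), ?_⟩
  intro i q hq y hy
  show _ = _
  rw [h₁.sides i q hq y hy, h₂.sides i q hq y hy]

/-- products. [folklore] -/
theorem StripHolo.mul {G₁ G₂ : (Fin (d + 1) → ℂ) → ℂ} {κ : ℝ} (h₁ : StripHolo G₁ κ) (h₂ : StripHolo G₂ κ) :
    StripHolo (fun p => G₁ p * G₂ p) κ := by
  refine ⟨h₁.cont.mul h₂.cont, fun i q hq => (h₁.diff i q hq).mul (h₂.diff i q hq), ?_⟩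
  intro i q hq y hy
  show _ = _
  rw [h₁.sides i q hq y hy, h₂.sides i q hq y hy]

/-- finite sums. [folklore] -/
theorem StripHolo.finset_sum {ι : Type*} (s : Finset ι) {G : ι → (Fin (d + 1) → ℂ) → ℂ} {κ : ℝ}
    (h : ∀ a ∈ s, StripHolo (G a) κ) : StripHolo (fun p => ∑ a ∈ s, G a p) κ := by
  refine ⟨continuousOn_finsetSum s fun a ha => (h a ha).cont,
    fun i q hq => DifferentiableOn.fun_sum fun a ha => (h a ha).diff i q hq, ?_⟩
  intro i q hq y hy
  exact Finset.sum_congr rfl fun a ha => (h a ha).sides i q hq y hy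

/-- finite products. [folklore] -/
theorem StripHolo.finset_prod {ι : Type*} (s : Finset ι) {G : ι → (Fin (d + 1) → ℂ) → ℂ} {κ : ℝ}
    (h : ∀ a ∈ s, StripHolo (G a) κ) : StripHolo (fun p => ∏ a ∈ s, G a p) κ := by
  refine ⟨continuousOn_finsetProd s fun a ha => (h a ha).cont,
    fun i q hq => DifferentiableOn.fun_finsetProd fun a ha => (h a ha).diff i q hq, ?_⟩
  intro i q hq y hy
  exact Finset.prod_congr rfl fun a ha => (h a ha).sides i q hq y hy

/-- the inverse of a strip-holomorphic multiplier WITHOUT ZEROS on the strip is strip holomorphic. [folklore] -/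
theorem StripHolo.inv {G : (Fin (d + 1) → ℂ) → ℂ} {κ : ℝ} (h : StripHolo G κ) (hκ : 0 ≤ κ)
    (hne : ∀ p ∈ Strip (d + 1) κ, G p ≠ 0) : StripHolo (fun p => (G p)⁻¹) κ := by
  refine ⟨h.cont.inv₀ hne, ?_, ?_⟩
  · intro i q hq
    refine (h.diff i q hq).inv ?_
    intro z hz
    exact hne _ (insertNth_mem_Strip hκ i hq (openRect_subset_closedRect κ hz))
  · intro i q hq y hy
    show _ = _
    rw [h.sides i q hq y hy]

/-- a strip-holomorphic multiplier bounded below by `c > 0` on the strip has a STRIP-REGULAR inverse with bound `c⁻¹`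
(`B4ContourShift.stripRegular_inv`, repackaged). [folklore] -/
theorem StripHolo.stripRegular_inv {G : (Fin (d + 1) → ℂ) → ℂ} {κ c : ℝ} (h : StripHolo G κ) (hκ : 0 ≤ κ)
    (hc : 0 < c) (lower : ∀ p ∈ Strip (d + 1) κ, c ≤ ‖G p‖) : StripRegular (fun p => (G p)⁻¹) κ c⁻¹ :=
  B4ContourShift.stripRegular_inv hκ hc h.cont h.diff h.sides lower

/-! ### §3. Matrix-valued multipliers: determinant, adjugate and inverse -/

section Matrix

variable {n : Type*} [Fintype n] [DecidableEq n]

/-- the DETERMINANT of an entrywise strip-holomorphic matrix multiplier is strip holomorphic (Leibniz formula). [folklore] -/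
theorem stripHolo_det {A : (Fin (d + 1) → ℂ) → Matrix n n ℂ} {κ : ℝ}
    (hA : ∀ i j, StripHolo (fun p => A p i j) κ) : StripHolo (fun p => (A p).det) κ := by
  have h : (fun p => (A p).det)
      = fun p => ∑ σ : Equiv.Perm n, ((Equiv.Perm.sign σ : ℤ) : ℂ) * ∏ i, A p (σ i) i := by
    funext p
    rw [Matrix.det_apply']
  rw [h]
  refine StripHolo.finset_sum _ fun σ _ => ?_
  exact (stripHolo_const _ κ).mul (StripHolo.finset_prod _ fun i _ => hA (σ i) i)

/-- the ADJUGATE entries of an entrywise strip-holomorphic matrix multiplier are strip holomorphic (each is the determinant of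
the matrix with one row replaced by a basis vector). [folklore] -/
theorem stripHolo_adjugate {A : (Fin (d + 1) → ℂ) → Matrix n n ℂ} {κ : ℝ}
    (hA : ∀ i j, StripHolo (fun p => A p i j) κ) (i j : n) :
    StripHolo (fun p => (A p).adjugate i j) κ := by
  have h : (fun p => (A p).adjugate i j) = fun p => ((A p).updateRow j (Pi.single i 1)).det := by
    funext p
    rw [Matrix.adjugate_apply]
  rw [h]
  refine stripHolo_det fun i' k => ?_
  by_cases hi' : i' = j
  · have h2 : (fun p => (A p).updateRow j (Pi.single i 1) i' k) = fun _ => (Pi.single i 1 : n → ℂ) k := by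
      funext p
      rw [Matrix.updateRow_apply, if_pos hi']
    rw [h2]
    exact stripHolo_const _ κ
  · have h2 : (fun p => (A p).updateRow j (Pi.single i 1) i' k) = fun p => A p i' k := by
      funext p
      rw [Matrix.updateRow_apply, if_neg hi']
    rw [h2]
    exact hA i' k

/-- over a field, the inverse matrix is `det⁻¹ • adjugate`, entrywise. [folklore] -/
theorem inv_apply_eq (B : Matrix n n ℂ) (i j : n) : B⁻¹ i j = (B.det)⁻¹ * B.adjugate i j := by
  rw [Matrix.inv_def, Ring.inverse_eq_inv, Matrix.smul_apply, smul_eq_mul]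

/-- injectivity of the matrix (as a map on vectors) at a point gives a nonzero determinant there — the form in which a
UNIQUENESS theorem for the fibre operator delivers the hypothesis of the next theorem. [folklore] -/
theorem det_ne_zero_of_mulVec_injective (B : Matrix n n ℂ) (h : Function.Injective B.mulVec) : B.det ≠ 0 := by
  have hU : IsUnit B := Matrix.mulVec_injective_iff_isUnit.mp h
  exact isUnit_iff_ne_zero.mp ((Matrix.isUnit_iff_isUnit_det B).mp hU)

/-- THE ENGINE OF THIS FILE.  Let `A : ℂ^{d+1} → Mat_n(ℂ)` be an entrywise strip-holomorphic matrix multiplier of half-width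
`κ₀ > 0` whose determinant does not vanish at the REAL momenta of the Brillouin zone.  Then on some strip of positive half-width
`κ ≤ κ₀` every entry of the inverse multiplier `p ↦ (A p)⁻¹` is STRIP REGULAR (`B4ContourShift.StripRegular`) with a common
bound `M ≥ 0`.  Proof: §1 bounds `|det A| ≥ c > 0` on a smaller strip, the adjugate entries are strip holomorphic hence bounded
on the compact strip, and `(A p)⁻¹ = (det A p)⁻¹ · adj(A p)`. [folklore] -/
theorem exists_stripRegular_inv {A : (Fin (d + 1) → ℂ) → Matrix n n ℂ} {κ₀ : ℝ} (hκ₀ : 0 < κ₀)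
    (hA : ∀ i j, StripHolo (fun p => A p i j) κ₀)
    (hdet : ∀ s ∈ BZ (d + 1), (A (ofRealVec s)).det ≠ 0) :
    ∃ κ M : ℝ, 0 < κ ∧ κ ≤ κ₀ ∧ 0 ≤ M ∧ ∀ i j, StripRegular (fun p => (A p)⁻¹ i j) κ M := by
  have hdetH : StripHolo (fun p => (A p).det) κ₀ := stripHolo_det hA
  obtain ⟨κ, c, hκ, hκle, hc, hlow⟩ := exists_strip_lower_of_ne_zero hκ₀ hdetH.cont hdet
  -- the inverse determinant on the small strip
  have hdetκ : StripHolo (fun p => (A p).det) κ := hdetH.of_le hκle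
  have hinv : StripRegular (fun p => ((A p).det)⁻¹) κ c⁻¹ := hdetκ.stripRegular_inv hκ.le hc hlow
  -- the adjugate entries on the small strip, with bounds
  have hadj : ∀ i j, ∃ M : ℝ, 0 ≤ M ∧ StripRegular (fun p => (A p).adjugate i j) κ M :=
    fun i j => ((stripHolo_adjugate hA i j).of_le hκle).exists_stripRegular
  choose Madj hMadj0 hMadj using hadj
  set M' : ℝ := ∑ i, ∑ j, Madj i j with hM'
  have hM'0 : 0 ≤ M' := Finset.sum_nonneg fun i _ => Finset.sum_nonneg fun j _ => hMadj0 i j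
  have hle : ∀ i j, Madj i j ≤ M' := by
    intro i j
    calc Madj i j ≤ ∑ j', Madj i j' :=
          Finset.single_le_sum (fun j' _ => hMadj0 i j') (Finset.mem_univ j)
      _ ≤ ∑ i', ∑ j', Madj i' j' :=
          Finset.single_le_sum (fun i' _ => Finset.sum_nonneg fun j' _ => hMadj0 i' j') (Finset.mem_univ i)
  refine ⟨κ, c⁻¹ * M', hκ, hκle, mul_nonneg (inv_pos.mpr hc).le hM'0, ?_⟩
  intro i j
  have h := hinv.mul ((hMadj i j).mono (hle i j)) (inv_pos.mpr hc).le
  have hfun : (fun p => (A p)⁻¹ i j) = fun p => ((A p).det)⁻¹ * (A p).adjugate i j := by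
    funext p
    exact inv_apply_eq (A p) i j
  rw [hfun]
  exact h

/-- … HENCE AN EXPONENTIALLY DECAYING INVERSE KERNEL (`B4ContourShift.latticeKernel_decay` applied entrywise): under the
hypotheses of `exists_stripRegular_inv` there are `κ > 0` and `M ≥ 0` with
`‖(2π)^{-(d+1)} ∫_{[-π,π]^{d+1}} ((A p)⁻¹)_{ij} e^{ip·x} dp‖ ≤ M e^{−κ|x|_∞}` for all `i, j` and all `x ∈ ℤ^{d+1}`. [folklore] -/
theorem inv_latticeKernel_decay {A : (Fin (d + 1) → ℂ) → Matrix n n ℂ} {κ₀ : ℝ} (hκ₀ : 0 < κ₀)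
    (hA : ∀ i j, StripHolo (fun p => A p i j) κ₀)
    (hdet : ∀ s ∈ BZ (d + 1), (A (ofRealVec s)).det ≠ 0) :
    ∃ κ M : ℝ, 0 < κ ∧ κ ≤ κ₀ ∧ 0 ≤ M ∧ ∀ i j (x : Fin (d + 1) → ℤ),
      ‖latticeKernel (fun p => (A p)⁻¹ i j) x‖ ≤ M * Real.exp (-(κ * supNorm x)) := by
  obtain ⟨κ, M, hκ, hκle, hM, hreg⟩ := exists_stripRegular_inv hκ₀ hA hdet
  exact ⟨κ, M, hκ, hκle, hM, fun i j x => latticeKernel_decay (hreg i j) hκ.le x⟩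

/-- the same with the UNIQUENESS form of the hypothesis: `A(p)` injective on vectors at every real momentum of the zone.
[folklore] -/
theorem inv_latticeKernel_decay_of_injective {A : (Fin (d + 1) → ℂ) → Matrix n n ℂ} {κ₀ : ℝ} (hκ₀ : 0 < κ₀)
    (hA : ∀ i j, StripHolo (fun p => A p i j) κ₀)
    (hinj : ∀ s ∈ BZ (d + 1), Function.Injective (A (ofRealVec s)).mulVec) :
    ∃ κ M : ℝ, 0 < κ ∧ κ ≤ κ₀ ∧ 0 ≤ M ∧ ∀ i j (x : Fin (d + 1) → ℤ),
      ‖latticeKernel (fun p => (A p)⁻¹ i j) x‖ ≤ M * Real.exp (-(κ * supNorm x)) :=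
  inv_latticeKernel_decay hκ₀ hA fun s hs => det_ne_zero_of_mulVec_injective _ (hinj s hs)

/-- the `ℓ¹` norm is at most `d+1` times the sup norm. [folklore] -/
theorem sum_abs_le_mul_supNorm (x : Fin (d + 1) → ℤ) : ∑ μ, |(x μ : ℝ)| ≤ (d + 1) * supNorm x := by
  calc ∑ μ, |(x μ : ℝ)| ≤ ∑ _μ : Fin (d + 1), supNorm x :=
        Finset.sum_le_sum fun μ _ => by rw [← Int.cast_abs]; exact abs_le_supNorm x μ
    _ = (d + 1) * supNorm x := by simp [Finset.sum_const, Finset.card_univ, Fintype.card_fin]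

/-- sup-norm decay at rate `κ` is `ℓ¹`-norm decay at rate `κ/(d+1)` (the shape `|K(x)| ≤ M e^{−δ₁|x|₁}` used by the cell's
`B12Sec2to5.Decay510`). [folklore] -/
theorem exp_supNorm_le_exp_l1 {κ : ℝ} (hκ : 0 ≤ κ) (x : Fin (d + 1) → ℤ) :
    Real.exp (-(κ * supNorm x)) ≤ Real.exp (-(κ / (d + 1)) * ∑ μ, |(x μ : ℝ)|) := by
  refine Real.exp_le_exp.mpr ?_
  have hd : (0 : ℝ) < d + 1 := by positivity
  have h := sum_abs_le_mul_supNorm x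
  have h2 : κ / (d + 1) * ∑ μ, |(x μ : ℝ)| ≤ κ * supNorm x := by
    calc κ / (d + 1) * ∑ μ, |(x μ : ℝ)| ≤ κ / (d + 1) * ((d + 1) * supNorm x) :=
          mul_le_mul_of_nonneg_left h (div_nonneg hκ hd.le)
      _ = κ * supNorm x := by field_simp
  linarith

/-- `ℓ¹` form of `inv_latticeKernel_decay`. [folklore] -/
theorem inv_latticeKernel_decay_l1 {A : (Fin (d + 1) → ℂ) → Matrix n n ℂ} {κ₀ : ℝ} (hκ₀ : 0 < κ₀)
    (hA : ∀ i j, StripHolo (fun p => A p i j) κ₀)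
    (hdet : ∀ s ∈ BZ (d + 1), (A (ofRealVec s)).det ≠ 0) :
    ∃ δ M : ℝ, 0 < δ ∧ 0 ≤ M ∧ ∀ i j (x : Fin (d + 1) → ℤ),
      ‖latticeKernel (fun p => (A p)⁻¹ i j) x‖ ≤ M * Real.exp (-(δ * ∑ μ, |(x μ : ℝ)|)) := by
  obtain ⟨κ, M, hκ, _, hM, h⟩ := inv_latticeKernel_decay hκ₀ hA hdet
  refine ⟨κ / (d + 1), M, div_pos hκ (by positivity), hM, fun i j x => ?_⟩
  have h1 := (h i j x).trans (mul_le_mul_of_nonneg_left (exp_supNorm_le_exp_l1 hκ.le x) hM)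
  rwa [neg_mul] at h1

end Matrix

/-! ### §4. Trigonometric-polynomial matrix multipliers (the fibre matrices of a finite-range operator periodic under a
sublattice): entire and `2π`-periodic, so the engine applies on every strip -/

/-- the character `e^{i p·a}` of the lattice vector `a ∈ ℤ^{d+1}` at the complex momentum `p`. [folklore] -/
def cphase (a : Fin (d + 1) → ℤ) (p : Fin (d + 1) → ℂ) : ℂ := cexp (I * ∑ μ, p μ * (a μ : ℂ))

/-- the character is an entire function of each coordinate (through any base point). [folklore] -/
theorem differentiable_cphase_slice (a : Fin (d + 1) → ℤ) (i : Fin (d + 1)) (w : Fin d → ℂ) :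
    Differentiable ℂ (fun z : ℂ => cphase a (i.insertNth z w)) := by
  unfold cphase
  refine (Differentiable.const_mul ?_ I).cexp
  refine Differentiable.fun_sum fun μ _ => ?_
  refine Differentiable.mul_const ?_ _
  refine Fin.succAboveCases i ?_ ?_ μ
  · simp only [Fin.insertNth_apply_same]
    exact differentiable_id
  · intro k
    simp only [Fin.insertNth_apply_succAbove]
    exact differentiable_const _

/-- the character is continuous. [folklore] -/
theorem continuous_cphase (a : Fin (d + 1) → ℤ) : Continuous (cphase (d := d) a) := by
  unfold cphase
  fun_prop

/-- the character is `2π`-periodic in each coordinate. [folklore] -/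
theorem cphase_periodic (a : Fin (d + 1) → ℤ) (i : Fin (d + 1)) (p : Fin (d + 1) → ℂ) :
    cphase a (Function.update p i (p i + 2 * π)) = cphase a p := by
  unfold cphase
  have hsum : ∑ μ, (Function.update p i (p i + 2 * π)) μ * (a μ : ℂ)
      = (∑ μ, p μ * (a μ : ℂ)) + 2 * π * (a i : ℂ) := by
    have h1 : ∀ μ, (Function.update p i (p i + 2 * π)) μ * (a μ : ℂ)
        = p μ * (a μ : ℂ) + (if μ = i then 2 * π * (a i : ℂ) else 0) := by
      intro μ
      by_cases hμ : μ = i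
      · subst hμ
        simp only [Function.update_self, if_true]
        ring
      · rw [Function.update_of_ne hμ, if_neg hμ, add_zero]
    simp_rw [h1]
    rw [Finset.sum_add_distrib, Finset.sum_ite_eq' Finset.univ i, if_pos (Finset.mem_univ i)]
  rw [hsum, mul_add, Complex.exp_add]
  have h2 : cexp (I * (2 * π * (a i : ℂ))) = 1 := by
    have : I * (2 * π * (a i : ℂ)) = (a i : ℂ) * (2 * π * I) := by ring
    rw [this]
    exact Complex.exp_int_mul_two_pi_mul_I (a i)
  rw [h2, mul_one]

/-- the character is strip holomorphic on EVERY strip. [folklore] -/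
theorem stripHolo_cphase (a : Fin (d + 1) → ℤ) (κ : ℝ) : StripHolo (cphase a) κ :=
  ⟨(continuous_cphase a).continuousOn,
    fun i q _ => (differentiable_cphase_slice a i (ofRealVec q)).differentiableOn,
    fun i q _ y _ => sides_of_periodic (cphase a) (cphase_periodic a) i q y⟩

section TrigPoly

variable {n : Type*}

/-- a TRIGONOMETRIC-POLYNOMIAL MATRIX MULTIPLIER `A(p) = Σ_{a ∈ S} e^{i p·a} L_a` with finitely many matrix coefficients
`L_a ∈ Mat_n(ℂ)` — the Floquet–Bloch fibre matrix of a finite-range lattice operator that commutes with the translations of a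
sublattice (coarse displacement `a`, intra-cell labels = the matrix indices). [folklore] -/
def trigPolySymbol (S : Finset (Fin (d + 1) → ℤ)) (L : (Fin (d + 1) → ℤ) → Matrix n n ℂ)
    (p : Fin (d + 1) → ℂ) : Matrix n n ℂ :=
  ∑ a ∈ S, cphase a p • L a

/-- its entries are the scalar trigonometric polynomials `Σ_{a ∈ S} e^{i p·a} (L_a)_{ij}`. [folklore] -/
theorem trigPolySymbol_apply (S : Finset (Fin (d + 1) → ℤ)) (L : (Fin (d + 1) → ℤ) → Matrix n n ℂ)
    (p : Fin (d + 1) → ℂ) (i j : n) : trigPolySymbol S L p i j = ∑ a ∈ S, cphase a p * L a i j := by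
  unfold trigPolySymbol
  rw [Matrix.sum_apply]
  refine Finset.sum_congr rfl fun a _ => ?_
  rw [Matrix.smul_apply, smul_eq_mul]

/-- its entries are strip holomorphic on every strip. [folklore] -/
theorem stripHolo_trigPolySymbol (S : Finset (Fin (d + 1) → ℤ)) (L : (Fin (d + 1) → ℤ) → Matrix n n ℂ) (κ : ℝ)
    (i j : n) : StripHolo (fun p => trigPolySymbol S L p i j) κ := by
  have h : (fun p => trigPolySymbol S L p i j) = fun p => ∑ a ∈ S, cphase a p * L a i j := by
    funext p
    exact trigPolySymbol_apply S L p i j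
  rw [h]
  exact StripHolo.finset_sum S fun a _ => (stripHolo_cphase a κ).mul (stripHolo_const _ κ)

variable [Fintype n] [DecidableEq n]

/-- THE FLOQUET CONCLUSION FOR FINITE-RANGE FIBRE MATRICES: if the trigonometric-polynomial matrix multiplier `A(p)` is
nonsingular at every REAL momentum of the Brillouin zone, then the lattice kernel of every entry of `A(p)⁻¹` decays
exponentially: `∃ κ > 0, M ≥ 0, ‖K_{ij}(x)‖ ≤ M e^{−κ|x|_∞}` for all `i, j, x`. [folklore] -/
theorem trigPolySymbol_inv_decay (S : Finset (Fin (d + 1) → ℤ)) (L : (Fin (d + 1) → ℤ) → Matrix n n ℂ)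
    (hdet : ∀ s ∈ BZ (d + 1), (trigPolySymbol S L (ofRealVec s)).det ≠ 0) :
    ∃ κ M : ℝ, 0 < κ ∧ 0 ≤ M ∧ ∀ i j (x : Fin (d + 1) → ℤ),
      ‖latticeKernel (fun p => (trigPolySymbol S L p)⁻¹ i j) x‖ ≤ M * Real.exp (-(κ * supNorm x)) := by
  obtain ⟨κ, M, hκ, _, hM, h⟩ := inv_latticeKernel_decay (n := n) one_pos
    (fun i j => stripHolo_trigPolySymbol S L 1 i j) hdet
  exact ⟨κ, M, hκ, hM, h⟩

/-- the same with the UNIQUENESS form of the hypothesis (injectivity of `A(p)` on vectors at every real momentum). [folklore] -/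
theorem trigPolySymbol_inv_decay_of_injective (S : Finset (Fin (d + 1) → ℤ))
    (L : (Fin (d + 1) → ℤ) → Matrix n n ℂ)
    (hinj : ∀ s ∈ BZ (d + 1), Function.Injective (trigPolySymbol S L (ofRealVec s)).mulVec) :
    ∃ κ M : ℝ, 0 < κ ∧ 0 ≤ M ∧ ∀ i j (x : Fin (d + 1) → ℤ),
      ‖latticeKernel (fun p => (trigPolySymbol S L p)⁻¹ i j) x‖ ≤ M * Real.exp (-(κ * supNorm x)) :=
  trigPolySymbol_inv_decay S L fun s hs => det_ne_zero_of_mulVec_injective _ (hinj s hs)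

/-- the strip-regular form (for consumers that periodise on a torus with `B4TorusKernel.torusKernel_descend_eq`): on some
positive strip all entries of the inverse multiplier are `StripRegular` with a common bound. [folklore] -/
theorem trigPolySymbol_exists_stripRegular_inv (S : Finset (Fin (d + 1) → ℤ))
    (L : (Fin (d + 1) → ℤ) → Matrix n n ℂ)
    (hdet : ∀ s ∈ BZ (d + 1), (trigPolySymbol S L (ofRealVec s)).det ≠ 0) :
    ∃ κ M : ℝ, 0 < κ ∧ 0 ≤ M ∧ ∀ i j, StripRegular (fun p => (trigPolySymbol S L p)⁻¹ i j) κ M := by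
  obtain ⟨κ, M, hκ, _, hM, h⟩ := exists_stripRegular_inv (n := n) one_pos
    (fun i j => stripHolo_trigPolySymbol S L 1 i j) hdet
  exact ⟨κ, M, hκ, hM, h⟩

/-! ### §5. The inverse kernel is the two-sided FUNDAMENTAL SOLUTION of the finite-difference operator `Σ_a L_a τ_a`
(shift rule `B4Green244.latticeKernel_phase_mul` + superposition `latticeKernel_sum_mul` + `latticeKernel_one`) -/

/-- the character of this file is `B4Green244`'s phase: `cphase a p = exp(i·phaseC p a)`. [folklore] -/
theorem cphase_eq_phaseC (a : Fin (d + 1) → ℤ) (p : Fin (d + 1) → ℂ) :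
    cphase a p = cexp (I * B4Green244.phaseC p a) := rfl

/-- THE INVERSE KERNEL (matrix valued): `K(x)_{ij} = (2π)^{-(d+1)} ∫_{[-π,π]^{d+1}} (A(p)⁻¹)_{ij} e^{ip·x} dp`. [folklore] -/
def invKernel (S : Finset (Fin (d + 1) → ℤ)) (L : (Fin (d + 1) → ℤ) → Matrix n n ℂ)
    (x : Fin (d + 1) → ℤ) : Matrix n n ℂ :=
  Matrix.of fun i j => latticeKernel (fun p => (trigPolySymbol S L p)⁻¹ i j) x

/-- unfolding. [folklore] -/
theorem invKernel_apply (S : Finset (Fin (d + 1) → ℤ)) (L : (Fin (d + 1) → ℤ) → Matrix n n ℂ)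
    (x : Fin (d + 1) → ℤ) (i j : n) :
    invKernel S L x i j = latticeKernel (fun p => (trigPolySymbol S L p)⁻¹ i j) x := rfl

/-- the inverse kernel DECAYS EXPONENTIALLY in the sup norm, entrywise with common constants, as soon as the multiplier is
nonsingular on the real zone. [folklore] -/
theorem invKernel_decay (S : Finset (Fin (d + 1) → ℤ)) (L : (Fin (d + 1) → ℤ) → Matrix n n ℂ)
    (hdet : ∀ s ∈ BZ (d + 1), (trigPolySymbol S L (ofRealVec s)).det ≠ 0) :
    ∃ κ M : ℝ, 0 < κ ∧ 0 ≤ M ∧ ∀ i j (x : Fin (d + 1) → ℤ),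
      ‖invKernel S L x i j‖ ≤ M * Real.exp (-(κ * supNorm x)) :=
  trigPolySymbol_inv_decay S L hdet

/-- `ℓ¹` form (the shape of the cell's `B12Sec2to5.Decay510 (fun x => ‖K x i j‖) M δ`, up to unfolding `l1`). [folklore] -/
theorem invKernel_decay_l1 (S : Finset (Fin (d + 1) → ℤ)) (L : (Fin (d + 1) → ℤ) → Matrix n n ℂ)
    (hdet : ∀ s ∈ BZ (d + 1), (trigPolySymbol S L (ofRealVec s)).det ≠ 0) :
    ∃ δ M : ℝ, 0 < δ ∧ 0 ≤ M ∧ ∀ i j (x : Fin (d + 1) → ℤ),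
      ‖invKernel S L x i j‖ ≤ M * Real.exp (-(δ * ∑ μ, |(x μ : ℝ)|)) := by
  obtain ⟨δ, M, hδ, hM, h⟩ := inv_latticeKernel_decay_l1 (n := n) one_pos
    (fun i j => stripHolo_trigPolySymbol S L 1 i j) hdet
  exact ⟨δ, M, hδ, hM, h⟩

/-- the kernel of a constant multiplier is the constant times `δ_{x,0}`. [folklore] -/
theorem latticeKernel_const (c : ℂ) (x : Fin (d + 1) → ℤ) :
    latticeKernel (fun _ : Fin (d + 1) → ℂ => c) x = if x = 0 then c else 0 := by
  have h1 : integrand (fun _ : Fin (d + 1) → ℂ => c) x = fun p => c * integrand (fun _ => (1 : ℂ)) x p := by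
    funext p
    unfold integrand
    ring
  have h2 : latticeKernel (fun _ : Fin (d + 1) → ℂ => c) x = c * latticeKernel (fun _ => (1 : ℂ)) x := by
    unfold latticeKernel fourierBox
    rw [h1, MeasureTheory.integral_const_mul, mul_smul_comm]
  rw [h2, B4Green244.latticeKernel_one]
  split_ifs <;> simp

/-- every entry of the inverse multiplier, multiplied by a character, has an integrable integrand on the zone (it is strip
regular on a positive strip). [folklore] -/
theorem integrableOn_cphase_mul_inv (S : Finset (Fin (d + 1) → ℤ)) (L : (Fin (d + 1) → ℤ) → Matrix n n ℂ)
    (hdet : ∀ s ∈ BZ (d + 1), (trigPolySymbol S L (ofRealVec s)).det ≠ 0) (a : Fin (d + 1) → ℤ) (k j : n)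
    (x : Fin (d + 1) → ℤ) :
    MeasureTheory.IntegrableOn (integrand (fun p => cphase a p * (trigPolySymbol S L p)⁻¹ k j) x) (BZ (d + 1)) := by
  obtain ⟨κ, M, hκ, hM, hreg⟩ := trigPolySymbol_exists_stripRegular_inv S L hdet
  obtain ⟨M₁, hM₁, h₁⟩ := (stripHolo_cphase (d := d) a κ).exists_stripRegular
  exact (h₁.mul (hreg k j) hM₁).integrableOn hκ.le x

/-- the same with the character on the right of the inverse entry. [folklore] -/
theorem integrableOn_inv_mul_cphase (S : Finset (Fin (d + 1) → ℤ)) (L : (Fin (d + 1) → ℤ) → Matrix n n ℂ)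
    (hdet : ∀ s ∈ BZ (d + 1), (trigPolySymbol S L (ofRealVec s)).det ≠ 0) (a : Fin (d + 1) → ℤ) (i k : n)
    (x : Fin (d + 1) → ℤ) :
    MeasureTheory.IntegrableOn (integrand (fun p => cphase a p * ((trigPolySymbol S L p)⁻¹ i k)) x) (BZ (d + 1)) :=
  integrableOn_cphase_mul_inv S L hdet a i k x

/-- at a real momentum of the zone the multiplier is invertible: `A(p) A(p)⁻¹ = 1`. [folklore] -/
theorem mul_inv_of_real (S : Finset (Fin (d + 1) → ℤ)) (L : (Fin (d + 1) → ℤ) → Matrix n n ℂ)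
    (hdet : ∀ s ∈ BZ (d + 1), (trigPolySymbol S L (ofRealVec s)).det ≠ 0) {s : Fin (d + 1) → ℝ}
    (hs : s ∈ BZ (d + 1)) :
    trigPolySymbol S L (ofRealVec s) * (trigPolySymbol S L (ofRealVec s))⁻¹ = 1 :=
  Matrix.mul_nonsing_inv _ (isUnit_iff_ne_zero.mpr (hdet s hs))

/-- … and `A(p)⁻¹ A(p) = 1`. [folklore] -/
theorem inv_mul_of_real (S : Finset (Fin (d + 1) → ℤ)) (L : (Fin (d + 1) → ℤ) → Matrix n n ℂ)
    (hdet : ∀ s ∈ BZ (d + 1), (trigPolySymbol S L (ofRealVec s)).det ≠ 0) {s : Fin (d + 1) → ℝ}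
    (hs : s ∈ BZ (d + 1)) :
    (trigPolySymbol S L (ofRealVec s))⁻¹ * trigPolySymbol S L (ofRealVec s) = 1 :=
  Matrix.nonsing_inv_mul _ (isUnit_iff_ne_zero.mpr (hdet s hs))

/-- THE FUNDAMENTAL-SOLUTION IDENTITY (left): `Σ_{a ∈ S} L_a K(x + a) = δ_{x,0} 1` — the inverse kernel is the Green's
function of the finite-difference operator `(𝕃u)(x) = Σ_{a ∈ S} L_a u(x + a)` whose fibre matrices are `A(p)`. [folklore] -/
theorem fundamental_left (S : Finset (Fin (d + 1) → ℤ)) (L : (Fin (d + 1) → ℤ) → Matrix n n ℂ)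
    (hdet : ∀ s ∈ BZ (d + 1), (trigPolySymbol S L (ofRealVec s)).det ≠ 0) (x : Fin (d + 1) → ℤ) :
    ∑ a ∈ S, L a * invKernel S L (x + a) = if x = 0 then 1 else 0 := by
  ext i j
  rw [Matrix.sum_apply]
  -- Steps 1–2: shift rule termwise, then superposition into ONE multiplier
  have key : ∑ a ∈ S, (L a * invKernel S L (x + a)) i j
      = latticeKernel (fun P => ∑ ak ∈ S ×ˢ Finset.univ,
          L ak.1 i ak.2 * (cphase ak.1 P * (trigPolySymbol S L P)⁻¹ ak.2 j)) x := by
    rw [B4Green244.latticeKernel_sum_mul (S ×ˢ Finset.univ) (fun ak => L ak.1 i ak.2)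
      (fun ak p => cphase ak.1 p * (trigPolySymbol S L p)⁻¹ ak.2 j) x
      (fun ak _ => integrableOn_cphase_mul_inv S L hdet ak.1 ak.2 j x), Finset.sum_product]
    refine Finset.sum_congr rfl fun a _ => ?_
    rw [Matrix.mul_apply]
    refine Finset.sum_congr rfl fun k _ => ?_
    dsimp only
    congr 1
    exact (B4Green244.latticeKernel_phase_mul (fun p => (trigPolySymbol S L p)⁻¹ k j) x a).symm
  -- Step 3: on the zone the multiplier is `(A A⁻¹)_{ij} = δ_{ij}`
  have h3 : ∀ s ∈ BZ (d + 1), (∑ ak ∈ S ×ˢ Finset.univ,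
      L ak.1 i ak.2 * (cphase ak.1 (ofRealVec s) * (trigPolySymbol S L (ofRealVec s))⁻¹ ak.2 j))
        = (1 : Matrix n n ℂ) i j := by
    intro s hs
    rw [← mul_inv_of_real S L hdet hs, Matrix.mul_apply, Finset.sum_product]
    dsimp only
    rw [Finset.sum_comm]
    refine Finset.sum_congr rfl fun k _ => ?_
    rw [trigPolySymbol_apply, Finset.sum_mul]
    refine Finset.sum_congr rfl fun a _ => ?_
    ring
  rw [key, B4Green244.latticeKernel_congr
    (G1 := fun P => ∑ ak ∈ S ×ˢ Finset.univ, L ak.1 i ak.2 * (cphase ak.1 P * (trigPolySymbol S L P)⁻¹ ak.2 j))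
    (G2 := fun _ => (1 : Matrix n n ℂ) i j) h3 x, latticeKernel_const]
  split_ifs <;> simp

/-- THE FUNDAMENTAL-SOLUTION IDENTITY (right): `Σ_{a ∈ S} K(x + a) L_a = δ_{x,0} 1`. [folklore] -/
theorem fundamental_right (S : Finset (Fin (d + 1) → ℤ)) (L : (Fin (d + 1) → ℤ) → Matrix n n ℂ)
    (hdet : ∀ s ∈ BZ (d + 1), (trigPolySymbol S L (ofRealVec s)).det ≠ 0) (x : Fin (d + 1) → ℤ) :
    ∑ a ∈ S, invKernel S L (x + a) * L a = if x = 0 then 1 else 0 := by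
  ext i j
  rw [Matrix.sum_apply]
  have key : ∑ a ∈ S, (invKernel S L (x + a) * L a) i j
      = latticeKernel (fun P => ∑ ak ∈ S ×ˢ Finset.univ,
          L ak.1 ak.2 j * (cphase ak.1 P * (trigPolySymbol S L P)⁻¹ i ak.2)) x := by
    rw [B4Green244.latticeKernel_sum_mul (S ×ˢ Finset.univ) (fun ak => L ak.1 ak.2 j)
      (fun ak p => cphase ak.1 p * (trigPolySymbol S L p)⁻¹ i ak.2) x
      (fun ak _ => integrableOn_cphase_mul_inv S L hdet ak.1 i ak.2 x), Finset.sum_product]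
    refine Finset.sum_congr rfl fun a _ => ?_
    rw [Matrix.mul_apply]
    refine Finset.sum_congr rfl fun k _ => ?_
    dsimp only
    rw [mul_comm]
    congr 1
    exact (B4Green244.latticeKernel_phase_mul (fun p => (trigPolySymbol S L p)⁻¹ i k) x a).symm
  have h3 : ∀ s ∈ BZ (d + 1), (∑ ak ∈ S ×ˢ Finset.univ,
      L ak.1 ak.2 j * (cphase ak.1 (ofRealVec s) * (trigPolySymbol S L (ofRealVec s))⁻¹ i ak.2))
        = (1 : Matrix n n ℂ) i j := by
    intro s hs
    rw [← inv_mul_of_real S L hdet hs, Matrix.mul_apply, Finset.sum_product]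
    dsimp only
    rw [Finset.sum_comm]
    refine Finset.sum_congr rfl fun k _ => ?_
    rw [trigPolySymbol_apply, Finset.mul_sum]
    refine Finset.sum_congr rfl fun a _ => ?_
    ring
  rw [key, B4Green244.latticeKernel_congr
    (G1 := fun P => ∑ ak ∈ S ×ˢ Finset.univ, L ak.1 ak.2 j * (cphase ak.1 P * (trigPolySymbol S L P)⁻¹ i ak.2))
    (G2 := fun _ => (1 : Matrix n n ℂ) i j) h3 x, latticeKernel_const]
  split_ifs <;> simp

end TrigPoly

end

end Literature.MathematicalPhysics.QuantumFieldTheory.Balaban1983to89.Beta.FibreInverseDecay
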